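import Summits.CriticalPhenomena.PercolationContinuityZ3.Theorems.PercNearOneGluingAdditiveGluingSandwichLemma3
import Summits.CriticalPhenomena.PercolationContinuityZ3.Theorems.PercNearOneGluingAdditiveGluingGoodStepBridge
import HarnessLib

/-!
# Crux `PercNearOneGluing.AdditiveGluing` (stmt-CriticalPhenomena-4576), line `subuniform-dead-pocket-maximum`
# — GOODNESS FOR TWO RELAYS: the registered conclusion of `stub_goodStep` for every `A` with `A.card ≤ 3`

Siege seat k41 on the hardest stub `stub_goodStep` (variation "C1 kernel first"); lands with
`--supports stmt-CriticalPhenomena-4576`, registered stub `stub_goodStepTwoRelays_k41`.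
No new definitions, no named facts.

`stub_goodStepTwoRelays_k41`: for `b ∈ A`, `o ∉ A`, `A.card ≤ 3` (at most two relays besides the
target), EVERY level `t` with `1 − t ≤ μ(a ↔ b)` on `A` and every selection `sel W ∈ A` satisfy the
skeleton's linear selection form of Kozma–Nitzan's good-quadruple inequality
(arXiv:2401.12397 §3.2 p. 12)
  `μ(o ↔ A, o ↮ b) + Σ_{W dead} μ(C(o) = W) · μ({sel W ↔ b in Wᶜ}ᶜ) ≤ t`
— with NO hypothesis on the position of the observer and no induction hypothesis.  This is the
kernel `|A ∖ b| = 2` of the line (lead c1, `Lines/subuniform-dead-pocket-maximum-goodstep-c1.md`: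
"C1: Pen ≤ Y₁ − X", 0 violations in ≈ 3000 adversarial exact instances, previously open; KN prove
the penalty-free statement (Thm 1) and goodness only for observers isolated in `G ∖ A` (Thms 4–5)).
Proof: the exchange normal form at the `τ`-minimiser `a₀` (`good_of_exchange`, seat k46's bridge)
plus the pocket Markov property reduce it to
`μ(a₀↔b, o↮b, o↔A) + Σ_{W dead, sel W = a₂} [μ(C(o)=W, a₀↔b) − μ(C(o)=W, a₂↔b)] ≤ μ(o↔b, a₀↮b)`,
which is Corollary L3 (`lemma3_sandwich`, part III of the sandwich-BHK files) for the sandwich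
family `{a₂ ∈ C(o) ∌ a₀} ∪ {C(o) = W : W dead, sel W = a₂}` after partitioning by the value of
`C(o)` (`real_inter_sandwichFamily`).  The general step (`|A ∖ b| ≥ 3`) is NOT claimed.
-/

noncomputable section

open MeasureTheory unitInterval
open Literature.Probability.LatticeModels (prodBernoulli)
open Literature.Probability.Percolation

namespace Summit.CriticalPhenomena.PercolationContinuityZ3.Theorems

/-! ### GOOD for two relays: the registered conclusion of `stub_goodStep` whenever `A.card ≤ 3` -/

section TwoRelays

open Finset in
/-- **Partition of a sandwich event by the values of `C(o)`.**  For the family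
`𝓕 = {S | a₂ ∈ S, a₀ ∉ S} ∪ {↑W | W ∈ R}` with `R` a set of dead pockets (`W ∩ A = ∅`, `a₂ ∈ A`),
and any event `E`:  `μ(E ∩ {C(o) ∈ 𝓕}) = μ(E ∩ {a₂ ∈ C(o), a₀ ∉ C(o)}) + Σ_{W ∈ R} μ({C(o) = W} ∩ E)`.
[folklore; Grimmett 1999 §1.3] -/
theorem real_inter_sandwichFamily {n : ℕ} (w : Sym2 (Fin n) → unitInterval) (A : Finset (Fin n))
    (o a₀ a₂ : Fin n) (ha₂A : a₂ ∈ A) (R : Finset (Finset (Fin n)))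
    (hR : ∀ W ∈ R, Disjoint W A) (E : Set (BondConfig (Fin n))) :
    (prodBernoulli w).real (E ∩ {ω | openCluster ω o ∈
        ({S : Set (Fin n) | a₂ ∈ S ∧ a₀ ∉ S} ∪ {S | ∃ W ∈ R, S = (W : Set (Fin n))})}) =
      (prodBernoulli w).real (E ∩ {ω | a₂ ∈ openCluster ω o ∧ a₀ ∉ openCluster ω o}) +
        ∑ W ∈ R, (prodBernoulli w).real (clusterIs o W ∩ E) := by
  classical
  set μ := prodBernoulli w with hμ
  set 𝓕 : Set (Set (Fin n)) := {S : Set (Fin n) | a₂ ∈ S ∧ a₀ ∉ S} ∪ {S | ∃ W ∈ R, S = (W : Set (Fin n))}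
    with h𝓕
  set f : BondConfig (Fin n) → Finset (Fin n) := fun ω => univ.filter fun v => v ∈ openCluster ω o
    with hf
  have hfib : ∀ W : Finset (Fin n), f ⁻¹' {W} = clusterIs o W := by
    intro W
    ext ω
    simp only [Set.mem_preimage, Set.mem_singleton_iff, mem_clusterIs, hf, Finset.ext_iff,
      Set.ext_iff, mem_filter, mem_univ, true_and, mem_coe]
  have hcoe : ∀ ω : BondConfig (Fin n), ((f ω : Finset (Fin n)) : Set (Fin n)) = openCluster ω o := by
    intro ω; ext v; simp [hf]
  -- `μ(S) = Σ_W μ({C(o) = W} ∩ S)` with `{C(o) = W} ∩ S = {C(o) = W} ∩ E` or `∅` according to `P W`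
  have key : ∀ (S : Set (BondConfig (Fin n))) (P : Finset (Fin n) → Prop),
      (∀ ω, ω ∈ S ↔ ω ∈ E ∧ P (f ω)) →
      μ.real S = ∑ W, (if P W then μ.real (clusterIs o W ∩ E) else 0) := by
    intro S P hS
    rw [← sigmaRec_sum_preimage_inter w f S]
    refine sum_congr rfl fun W _ => ?_
    by_cases hW : P W
    · rw [if_pos hW, hfib]
      congr 1
      ext ω
      simp only [Set.mem_inter_iff, mem_clusterIs]
      constructor
      · rintro ⟨hc, hωS⟩; exact ⟨hc, ((hS ω).1 hωS).1⟩
      · rintro ⟨hc, hωE⟩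
        refine ⟨hc, (hS ω).2 ⟨hωE, ?_⟩⟩
        have : f ω = W := by
          apply Finset.coe_injective; rw [hcoe, hc]
        rwa [this]
    · rw [if_neg hW]
      have : f ⁻¹' {W} ∩ S = ∅ := by
        ext ω
        simp only [Set.mem_inter_iff, Set.mem_preimage, Set.mem_singleton_iff,
          Set.mem_empty_iff_false, iff_false, not_and]
        intro hfW hωS
        exact hW (hfW ▸ ((hS ω).1 hωS).2)
      rw [this, measureReal_empty]
  have e1 := key (E ∩ {ω | openCluster ω o ∈ 𝓕})
    (fun W => (a₂ ∈ W ∧ a₀ ∉ W) ∨ W ∈ R) (fun ω => by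
      simp only [Set.mem_inter_iff, Set.mem_setOf_eq, h𝓕, Set.mem_union, ← hcoe, mem_coe]
      refine and_congr_right fun _ => or_congr Iff.rfl ⟨?_, fun h => ⟨f ω, h, rfl⟩⟩
      rintro ⟨W, hW, hWe⟩
      rwa [Finset.coe_injective hWe])
  have e2 := key (E ∩ {ω | a₂ ∈ openCluster ω o ∧ a₀ ∉ openCluster ω o})
    (fun W => a₂ ∈ W ∧ a₀ ∉ W) (fun ω => by
      simp only [Set.mem_inter_iff, Set.mem_setOf_eq, ← hcoe, mem_coe])
  have hexcl : ∀ W, W ∈ R → ¬ (a₂ ∈ W ∧ a₀ ∉ W) := fun W hWR hW =>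
    Finset.disjoint_left.1 (hR W hWR) hW.1 ha₂A
  have hR' : ∑ W ∈ R, μ.real (clusterIs o W ∩ E) =
      ∑ W, (if W ∈ R then μ.real (clusterIs o W ∩ E) else 0) := (Fintype.sum_ite_mem R _).symm
  rw [e1, e2, hR', ← sum_add_distrib]
  refine sum_congr rfl fun W _ => ?_
  by_cases hp : a₂ ∈ W ∧ a₀ ∉ W
  · have hr : W ∉ R := fun hr => hexcl W hr hp
    simp [hp, hr]
  · by_cases hr : W ∈ R
    · simp [hp, hr]
    · simp [hp, hr]

open Finset in
/-- **Goodness for two relays** — the registered conclusion of `stub_goodStep` for EVERY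
quadruple with `A.card ≤ 3` (`b ∈ A`, `o ∉ A`, so at most two relays besides the target; no
low-neighbour or induction hypothesis needed).  This is Kozma–Nitzan's good-quadruple inequality
(arXiv:2401.12397 §3.2 p. 12) `Φ(A) + Σ_{W dead} μ(C(o)=W)·(1 − τ_{G−W}(sel W)) ≤ max_a (1 − τ(a))`
for `|A ∖ b| ≤ 2` and an observer in arbitrary position — new (KN prove the penalty-free form,
Thm 1, and goodness only for observers isolated in `G ∖ A`, Thms 4–5); it is the kernel C1 of the
line `subuniform-dead-pocket-maximum` (lead c1's `…goodstep-c1.md`).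
Proof: exchange normal form at the `τ`-minimiser `a₀` (`good_of_exchange`, seat k46); the pocket
Markov property turns the penalty into `Σ_{W dead, sel W = a₂} [μ(C(o)=W, a₀↔b) − μ(C(o)=W, a₂↔b)]`
(terms with `sel W ∈ {a₀, b}` are `≤ 0`); Corollary L3 (`lemma3_sandwich`) for the sandwich family
`{a₂ ∈ C(o) ∌ a₀} ∪ {C(o) = W : W dead, sel W = a₂}` bounds `X(a₀) +` that sum by
`μ(o ↔ a₂ ↔ b, o ↮ a₀) ≤ μ(o ↔ b, a₀ ↮ b) = Y(a₀)`.
[cite: KozmaNitzan2024, §3.2 (p. 12), Lemma 3 (pp. 6–7)] -/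
theorem stub_goodStepTwoRelays_k41 : ∀ (n : ℕ) (w : Sym2 (Fin n) → unitInterval) (A : Finset (Fin n)) (o b : Fin n), b ∈ A → o ∉ A → A.card ≤ 3 → ∀ (t : ℝ) (sel : Finset (Fin n) → Fin n), (∀ W, sel W ∈ A) → (∀ a ∈ A, 1 - t ≤ (prodBernoulli w).real (openConn a b)) → (prodBernoulli w).real ((⋃ a ∈ A, openConn o a) ∩ (openConn o b)ᶜ) + ∑ W ∈ (Finset.univ : Finset (Finset (Fin n))).filter (fun W => o ∈ W ∧ Disjoint W A), (prodBernoulli w).real {ω : BondConfig (Fin n) | openCluster ω o = (W : Set (Fin n))} * (prodBernoulli w).real (openConnIn ((W : Set (Fin n))ᶜ) (sel W) b)ᶜ ≤ t := by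
  intro n w A o b hbA hoA hcard t sel hsel hlev
  classical
  set μ := prodBernoulli w with hμ
  have hms : ∀ s : Set (BondConfig (Fin n)), MeasurableSet s := fun s => (Set.toFinite s).measurableSet
  set D := (univ : Finset (Finset (Fin n))).filter (fun W => o ∈ W ∧ Disjoint W A) with hD
  -- `τ_W(b) = 1` on dead pockets; the complement of the selected connection
  have hτle : ∀ (W : Finset (Fin n)) (x : Fin n), μ.real (openConnIn ((W : Set (Fin n))ᶜ) x b) ≤ 1 :=
    fun W x => measureReal_le_one
  have hτb : ∀ W ∈ D, μ.real (openConnIn ((W : Set (Fin n))ᶜ) b b) = 1 := by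
    intro W hW
    rw [mem_filter] at hW
    have hbW : b ∈ ((W : Set (Fin n))ᶜ) := fun h => Finset.disjoint_left.1 hW.2.2 (mem_coe.1 h) hbA
    have : openConnIn ((W : Set (Fin n))ᶜ) b b = Set.univ :=
      Set.eq_univ_of_forall fun ω => ⟨hbW, hbW, SimpleGraph.Reachable.refl _⟩
    rw [this, probReal_univ]
  -- choose the relay `a₀`
  by_cases hA' : A.erase b = ∅
  · -- `A = {b}`: everything vanishes
    have hAb : ∀ a ∈ A, a = b := fun a ha => by
      by_contra hne
      have : a ∈ A.erase b := mem_erase.2 ⟨hne, ha⟩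
      rw [hA'] at this
      exact notMem_empty a this
    refine good_of_exchange w A o b b hbA hbA t sel (hlev b hbA) ?_
    have hX : μ.real (openConn b b ∩ (openConn o b)ᶜ ∩ ⋃ a ∈ A, openConn o a) = 0 := by
      have : (openConn b b ∩ (openConn o b)ᶜ ∩ ⋃ a ∈ A, (openConn o a : Set (BondConfig (Fin n)))) = ∅ := by
        refine Set.eq_empty_iff_forall_notMem.2 fun ω hω => ?_
        obtain ⟨⟨_, hob⟩, hU⟩ := hω
        rw [Set.mem_iUnion₂] at hU
        obtain ⟨a, ha, hoa⟩ := hU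
        exact hob (hAb a ha ▸ hoa)
      rw [this, measureReal_empty]
    have hS : ∑ W ∈ D, μ.real {ω : BondConfig (Fin n) | openCluster ω o = (W : Set (Fin n))} *
        (μ.real (openConnIn ((W : Set (Fin n))ᶜ) b b) - μ.real (openConnIn ((W : Set (Fin n))ᶜ) (sel W) b)) = 0 :=
      sum_eq_zero fun W _ => by rw [hAb (sel W) (hsel W), sub_self, mul_zero]
    rw [hX, hS, zero_add]
    exact measureReal_nonneg
  -- `a₀` minimises `μ(· ↔ b)` over `A ∖ {b}`; `a₂` is the other relay (or `a₀`)
  obtain ⟨a₀, ha₀', hmin⟩ := exists_min_image (A.erase b) (fun a => μ.real (openConn a b))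
    (nonempty_iff_ne_empty.2 hA')
  have ha₀A : a₀ ∈ A := (mem_erase.1 ha₀').2
  have ha₀b : a₀ ≠ b := (mem_erase.1 ha₀').1
  obtain ⟨a₂, ha₂', hothers⟩ : ∃ a₂ ∈ A.erase b, ∀ a ∈ A.erase b, a = a₀ ∨ a = a₂ := by
    by_cases hex : ∃ a ∈ A.erase b, a ≠ a₀
    · obtain ⟨a₂, ha₂, hne⟩ := hex
      refine ⟨a₂, ha₂, fun a ha => ?_⟩
      by_contra hcon
      push Not at hcon
      have h3 : ({a₀, a₂, a} : Finset (Fin n)) ⊆ A.erase b := by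
        intro x hx
        simp only [mem_insert, mem_singleton] at hx
        rcases hx with rfl | rfl | rfl
        · exact ha₀'
        · exact ha₂
        · exact ha
      have hc3 : ({a₀, a₂, a} : Finset (Fin n)).card = 3 := by
        rw [card_insert_of_notMem, card_insert_of_notMem, card_singleton]
        · simpa using hcon.2.symm
        · simp only [mem_insert, mem_singleton, not_or]
          exact ⟨hne.symm, fun h => hcon.1 h.symm⟩
      have h' : (A.erase b).card ≤ 2 := by
        rw [card_erase_of_mem hbA]; omega
      have h4 := card_le_card h3
      rw [hc3] at h4
      omega
    · push Not at hex
      exact ⟨a₀, ha₀', fun a ha => Or.inl (hex a ha)⟩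
  have ha₂A : a₂ ∈ A := (mem_erase.1 ha₂').2
  have hAcases : ∀ a ∈ A, a = b ∨ a = a₀ ∨ a = a₂ := fun a ha => by
    by_cases hab : a = b
    · exact Or.inl hab
    · exact Or.inr (hothers a (mem_erase.2 ⟨hab, ha⟩))
  have hτ : μ.real (openConn a₀ b) ≤ μ.real (openConn a₂ b) := hmin a₂ ha₂'
  refine good_of_exchange w A o b a₀ hbA ha₀A t sel (hlev a₀ ha₀A) ?_
  -- the dead pockets selected to `a₂`, and the sandwich family
  set R := D.filter (fun W => sel W = a₂) with hR
  have hRdead : ∀ W ∈ R, Disjoint W A := fun W hW => by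
    rw [hR, mem_filter, hD, mem_filter] at hW
    exact hW.1.2.2
  have ha₀W : ∀ W ∈ D, a₀ ∉ W := fun W hW h => by
    rw [hD, mem_filter] at hW; exact Finset.disjoint_left.1 hW.2.2 h ha₀A
  have ha₂W : ∀ W ∈ D, a₂ ∉ W := fun W hW h => by
    rw [hD, mem_filter] at hW; exact Finset.disjoint_left.1 hW.2.2 h ha₂A
  -- (1) the penalty is at most the `a₂`-selected exchange sum
  have hpen : ∑ W ∈ D, μ.real {ω : BondConfig (Fin n) | openCluster ω o = (W : Set (Fin n))} *
      (μ.real (openConnIn ((W : Set (Fin n))ᶜ) a₀ b) - μ.real (openConnIn ((W : Set (Fin n))ᶜ) (sel W) b)) ≤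
      ∑ W ∈ R, (μ.real (clusterIs o W ∩ openConn a₀ b) - μ.real (clusterIs o W ∩ openConn a₂ b)) := by
    rw [← sum_filter_add_sum_filter_not D (fun W => sel W = a₂)]
    have h1 : ∑ W ∈ D.filter (fun W => sel W = a₂),
        μ.real {ω : BondConfig (Fin n) | openCluster ω o = (W : Set (Fin n))} *
          (μ.real (openConnIn ((W : Set (Fin n))ᶜ) a₀ b) - μ.real (openConnIn ((W : Set (Fin n))ᶜ) (sel W) b)) =
        ∑ W ∈ R, (μ.real (clusterIs o W ∩ openConn a₀ b) - μ.real (clusterIs o W ∩ openConn a₂ b)) := by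
      refine sum_congr rfl fun W hW => ?_
      have hWD : W ∈ D := (mem_filter.1 hW).1
      rw [(mem_filter.1 hW).2, goodBridge_setOf_eq_clusterIs, mul_sub,
        ← goodBridge_real_clusterIs_inter_openConn w W o a₀ b (ha₀W W hWD),
        ← goodBridge_real_clusterIs_inter_openConn w W o a₂ b (ha₂W W hWD)]
    have h2 : ∑ W ∈ D.filter (fun W => ¬ sel W = a₂),
        μ.real {ω : BondConfig (Fin n) | openCluster ω o = (W : Set (Fin n))} *
          (μ.real (openConnIn ((W : Set (Fin n))ᶜ) a₀ b) - μ.real (openConnIn ((W : Set (Fin n))ᶜ) (sel W) b)) ≤ 0 := by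
      refine sum_nonpos fun W hW => ?_
      have hWD : W ∈ D := (mem_filter.1 hW).1
      refine mul_nonpos_of_nonneg_of_nonpos measureReal_nonneg ?_
      rcases hAcases (sel W) (hsel W) with h | h | h
      · rw [h, hτb W hWD]; linarith [hτle W a₀]
      · rw [h]; simp
      · exact absurd h (mem_filter.1 hW).2
    linarith
  -- (2) `X(a₀) ≤ μ(a₀↔b, a₂ ∈ C(o), a₀ ∉ C(o))` and `μ(a₂↔b, a₂ ∈ C(o), a₀ ∉ C(o)) ≤ Y(a₀)`
  set P₀ : Set (BondConfig (Fin n)) := {ω | a₂ ∈ openCluster ω o ∧ a₀ ∉ openCluster ω o} with hP₀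
  have hX : μ.real (openConn a₀ b ∩ (openConn o b)ᶜ ∩ ⋃ a ∈ A, openConn o a) ≤ μ.real (openConn a₀ b ∩ P₀) := by
    refine measureReal_mono fun ω hω => ?_
    obtain ⟨⟨h0b, hob⟩, hU⟩ := hω
    rw [Set.mem_iUnion₂] at hU
    obtain ⟨a, ha, hoa⟩ := hU
    have h0b' : (openGraph ω).Reachable a₀ b := h0b
    have hoa' : (openGraph ω).Reachable o a := hoa
    have hno0 : a₀ ∉ openCluster ω o := fun h => hob ((show (openGraph ω).Reachable o a₀ from h).trans h0b')
    refine ⟨h0b, ?_, hno0⟩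
    rcases hAcases a ha with rfl | rfl | rfl
    · exact absurd hoa hob
    · exact absurd hoa' hno0
    · exact hoa'
  have hY : μ.real (openConn a₂ b ∩ P₀) ≤ μ.real (openConn o b ∩ (openConn a₀ b)ᶜ) := by
    refine measureReal_mono fun ω hω => ?_
    obtain ⟨h2b, ho2, hno0⟩ := hω
    have hob : (openGraph ω).Reachable o b := (show (openGraph ω).Reachable o a₂ from ho2).trans h2b
    exact ⟨hob, fun h0b => hno0 (hob.trans (show (openGraph ω).Reachable a₀ b from h0b).symm)⟩
  -- (3) Corollary L3 for the sandwich family, and the partition of both sides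
  set 𝓕 : Set (Set (Fin n)) := {S : Set (Fin n) | a₂ ∈ S ∧ a₀ ∉ S} ∪ {S | ∃ W ∈ R, S = (W : Set (Fin n))}
    with h𝓕
  have hL3 := lemma3_sandwich w a₀ a₂ b o 𝓕
    (fun ω h2 h0 => Or.inl ⟨h2, h0⟩)
    (fun ω hω => by
      rcases hω with ⟨_, h0⟩ | ⟨W, hW, hWe⟩
      · exact h0
      · intro h0
        rw [hWe] at h0
        exact ha₀W W (mem_filter.1 hW).1 (mem_coe.1 h0))
    hτ
  have e0 := real_inter_sandwichFamily w A o a₀ a₂ ha₂A R hRdead (openConn a₀ b)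
  have e2 := real_inter_sandwichFamily w A o a₀ a₂ ha₂A R hRdead (openConn a₂ b)
  rw [e0, e2] at hL3
  have hsum : ∑ W ∈ R, (μ.real (clusterIs o W ∩ openConn a₀ b) - μ.real (clusterIs o W ∩ openConn a₂ b)) =
      ∑ W ∈ R, μ.real (clusterIs o W ∩ openConn a₀ b) - ∑ W ∈ R, μ.real (clusterIs o W ∩ openConn a₂ b) :=
    sum_sub_distrib _ _
  linarith

end TwoRelays

end Summit.CriticalPhenomena.PercolationContinuityZ3.Theorems
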